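import Literature.NumberTheory.EllipticCurves.ManinConstantLegendreTwistProofs
import Literature.NumberTheory.EllipticCurves.FormalMulTwoLowOrderProofs
import Literature.NumberTheory.EllipticCurves.FormalMulTwoSecondCoeffProofs
import Literature.NumberTheory.GaloisRepresentations.TeichmullerCharacter
import HarnessLib

/-!
# Route `IsogenyGlueCongruence`, crux `MazurKenkuBound` (stmt-ABC-15125) — line `Sketch`,
# stub `stub_potGoodTwo`, part 1: the `2`-integral flex point and the elementary inputs

Elementary inputs of the assembly `stub_potGoodTwo` (`‖q‖₂ ≤ 1` for the data of Edixhoven's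
integrality at an additive prime `2` of potentially good reduction; part 2,
`IsogenyGlueCongruenceMazurKenkuBoundStubPotGoodTwo.lean`, imports this file). The registered
sub-goal proved here is `exists_flexPoint_padicAlgCl_two`: **a globally minimal `W'/ℚ` has a
`2`-integral point `(x₀, y₀) ∈ W'(ℚ̄₂)` with `Ψ₃(x₀) = 3x₀⁴ + b₂x₀³ + 3b₄x₀² + 3b₆x₀ + b₈ = 0`**
(`ℚ̄₂` is algebraically closed; `Ψ₃` has the `2`-adic unit `3` as leading coefficient and
integral coefficients, and `y₀` is a root of a monic integral quadratic, so both are integral by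
the ultrametric root bound). Around it, all folklore:

* `norm_le_one_of_quartic_eq_zero`: the ultrametric root bound — a root of
  `c₄x⁴ + c₃x³ + c₂x² + c₁x + c₀` with `‖c₄‖ = 1`, `‖cᵢ‖ ≤ 1` has norm `≤ 1`;
* `Δ_eq_of_flex`, `c₄_eq_of_flex`: the invariants `Δ = a₃³(a₁³ − 27a₃)`, `c₄ = a₁(a₁³ − 24a₃)`
  of a flex model `y² + a₁xy + a₃y = x³` (`a₂ = a₄ = a₆ = 0`);
* `scale_smul_flex`, `scale_mul_rst`: a pure scaling `(v, 0, 0, 0)` of a flex model is the flex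
  model `(v⁻¹a₁, 0, v⁻³a₃, 0, 0)`, and `(v, 0, 0, 0) * (1, r, s, t) = (v, r, s, t)`;
* `norm_c₄_pow_three_le_norm_Δ`: `‖j‖_p ≤ 1 ⇒ ‖c₄‖_p³ ≤ ‖Δ‖_p` (`jΔ = c₄³`);
* `padicValInt_c₄_le_seven_of_le`: Kraus at `2` — `v₂(Δ_min) ≥ 16 ⇒ c₄ ≠ 0 ∧ v₂(c₄) ≤ 7`
  (`not_pow_dvd_c₄_minimalDiscriminantInt_two`);
* `norm_two_padicAlgCl_two`, `norm_algebraMap_padicAlgCl`, `norm_coeff_padicAlgCl_le_one`: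
  `‖2‖ = 1/2` in `ℚ̄₂`, `‖r‖_{ℚ̄_p} = ‖r‖_p` for `r ∈ ℚ`, and the coefficients `aᵢ, bᵢ` of a
  globally minimal `W'` are `p`-integral (`map_integralModelInt`).

## References

* B. Edixhoven, *On the Manin constants of modular elliptic curves*, in: Arithmetic algebraic
  geometry (Texel, 1989), Progr. Math. 89 (1991), Prop. 2. [EdixhovenManin1991]
* J. H. Silverman, *The Arithmetic of Elliptic Curves*, 2nd ed. (2009), III.1 and Ex. 3.7,
  VII.5.5. [SilvermanAEC2009]
-/

-- `Summit.<Summit>.<Problem>` is the mandated summit-side namespace (CONVENTIONS §2); for the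
-- single-conjunct summit `ABC` the two coincide, so the duplicate `ABC.ABC` is deliberate.
set_option linter.dupNamespace false

noncomputable section

open scoped MatrixGroups ModularForm

open CongruenceSubgroup
open WeierstrassCurve
open PowerSeries
open Literature.NumberTheory.EllipticCurves
open Literature.NumberTheory.EllipticCurves.ModularForms
open Literature.NumberTheory.GaloisRepresentations
open Literature.NumberTheory.Automorphic

namespace Summit.ABC.ABC.Theorems

/-- **Ultrametric root bound.** In an ultrametric normed field, a root `x` of
`c₄x⁴ + c₃x³ + c₂x² + c₁x + c₀ = 0` with `‖c₄‖ = 1` and `‖cᵢ‖ ≤ 1` satisfies `‖x‖ ≤ 1`: if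
`‖x‖ > 1` the top term strictly dominates the others. [folklore] -/
theorem norm_le_one_of_quartic_eq_zero {F : Type*} [NormedField F] [IsUltrametricDist F]
    {c₄ c₃ c₂ c₁ c₀ x : F} (h₄ : ‖c₄‖ = 1) (h₃ : ‖c₃‖ ≤ 1) (h₂ : ‖c₂‖ ≤ 1) (h₁ : ‖c₁‖ ≤ 1)
    (h₀ : ‖c₀‖ ≤ 1) (h : c₄ * x ^ 4 + c₃ * x ^ 3 + c₂ * x ^ 2 + c₁ * x + c₀ = 0) :
    ‖x‖ ≤ 1 := by
  refine le_of_not_gt fun hx ↦ ?_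
  have hx1 : 1 ≤ ‖x‖ := hx.le
  have hx0 : 0 < ‖x‖ := one_pos.trans hx
  -- every lower term has norm at most `‖x‖³`
  have hterm : ∀ {c : F} {i : ℕ}, ‖c‖ ≤ 1 → i ≤ 3 → ‖c * x ^ i‖ ≤ ‖x‖ ^ 3 := by
    intro c i hc hi
    rw [norm_mul, norm_pow]
    calc ‖c‖ * ‖x‖ ^ i ≤ 1 * ‖x‖ ^ 3 :=
          mul_le_mul hc (pow_le_pow_right₀ hx1 hi) (by positivity) zero_le_one
      _ = ‖x‖ ^ 3 := one_mul _
  have key : ‖c₄ * x ^ 4‖ ≤ ‖x‖ ^ 3 := by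
    have e : c₄ * x ^ 4 = -(c₃ * x ^ 3 + c₂ * x ^ 2 + c₁ * x ^ 1 + c₀ * x ^ 0) := by
      rw [pow_one, pow_zero, mul_one]; linear_combination h
    rw [e, norm_neg]
    refine (IsUltrametricDist.norm_add_le_max _ _).trans (max_le ?_ (hterm h₀ (by norm_num)))
    refine (IsUltrametricDist.norm_add_le_max _ _).trans (max_le ?_ (hterm h₁ (by norm_num)))
    exact (IsUltrametricDist.norm_add_le_max _ _).trans
      (max_le (hterm h₃ le_rfl) (hterm h₂ (by norm_num)))
  rw [norm_mul, norm_pow, h₄, one_mul, pow_succ] at key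
  exact absurd ((mul_le_iff_le_one_right (pow_pos hx0 3)).mp key) (not_le.mpr hx)

/-- In an ultrametric normed field, `‖a‖, ‖b‖ ≤ 1 ⇒ ‖a + b‖ ≤ 1`. [folklore] -/
theorem norm_add_le_one {F : Type*} [NormedField F] [IsUltrametricDist F] {a b : F}
    (ha : ‖a‖ ≤ 1) (hb : ‖b‖ ≤ 1) : ‖a + b‖ ≤ 1 :=
  (IsUltrametricDist.norm_add_le_max _ _).trans (max_le ha hb)

/-- In a normed field, `‖a‖, ‖b‖ ≤ 1 ⇒ ‖ab‖ ≤ 1`. [folklore] -/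
theorem norm_mul_le_one {F : Type*} [NormedField F] {a b : F} (ha : ‖a‖ ≤ 1) (hb : ‖b‖ ≤ 1) :
    ‖a * b‖ ≤ 1 := by
  rw [norm_mul]; exact mul_le_one₀ ha (norm_nonneg _) hb

/-- **Invariants of a flex model**: for `y² + a₁xy + a₃y = x³` (`a₂ = a₄ = a₆ = 0`),
`Δ = a₃³(a₁³ − 27a₃)`. [cite: SilvermanAEC2009, III.1] -/
theorem Δ_eq_of_flex {R : Type*} [CommRing R] (W : WeierstrassCurve R) (h₂ : W.a₂ = 0)
    (h₄ : W.a₄ = 0) (h₆ : W.a₆ = 0) : W.Δ = W.a₃ ^ 3 * (W.a₁ ^ 3 - 27 * W.a₃) := by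
  simp only [WeierstrassCurve.Δ, WeierstrassCurve.b₂, WeierstrassCurve.b₄, WeierstrassCurve.b₆,
    WeierstrassCurve.b₈, h₂, h₄, h₆]
  ring

/-- **Invariants of a flex model**: for `y² + a₁xy + a₃y = x³` (`a₂ = a₄ = a₆ = 0`),
`c₄ = a₁(a₁³ − 24a₃)`. [cite: SilvermanAEC2009, III.1] -/
theorem c₄_eq_of_flex {R : Type*} [CommRing R] (W : WeierstrassCurve R) (h₂ : W.a₂ = 0)
    (h₄ : W.a₄ = 0) : W.c₄ = W.a₁ * (W.a₁ ^ 3 - 24 * W.a₃) := by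
  simp only [WeierstrassCurve.c₄, WeierstrassCurve.b₂, WeierstrassCurve.b₄, h₂, h₄]
  ring

/-- A pure scaling `(v, 0, 0, 0)` of a flex model `(a₁, 0, a₃, 0, 0)` is the flex model
`(v⁻¹a₁, 0, v⁻³a₃, 0, 0)`. [cite: SilvermanAEC2009, III.1, Table 3.1] -/
theorem scale_smul_flex {R : Type*} [CommRing R] (W : WeierstrassCurve R) (h₂ : W.a₂ = 0)
    (h₄ : W.a₄ = 0) (h₆ : W.a₆ = 0) (v : Rˣ) :
    (⟨v, 0, 0, 0⟩ : VariableChange R) • W =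
      ⟨((v⁻¹ : Rˣ) : R) * W.a₁, 0, ((v⁻¹ : Rˣ) : R) ^ 3 * W.a₃, 0, 0⟩ := by
  ext
  · simp only [variableChange_a₁, mul_zero, add_zero]
  · simp only [variableChange_a₂, h₂, zero_mul, sub_zero, mul_zero, add_zero, zero_pow two_ne_zero]
  · simp only [variableChange_a₃, zero_mul, add_zero, mul_zero]
  · simp only [variableChange_a₄, h₂, h₄, zero_mul, sub_zero, mul_zero, add_zero,
      zero_pow two_ne_zero]
  · simp only [variableChange_a₆, h₂, h₄, h₆, zero_mul, sub_zero, mul_zero, add_zero,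
      zero_pow two_ne_zero, zero_pow three_ne_zero]

/-- `(v, 0, 0, 0) * (1, r, s, t) = (v, r, s, t)` in the group of changes of variables (the
translation acts first). [cite: SilvermanAEC2009, III.1] -/
theorem scale_mul_rst {R : Type*} [CommRing R] (v : Rˣ) (r s t : R) :
    (⟨v, 0, 0, 0⟩ : VariableChange R) * ⟨1, r, s, t⟩ = ⟨v, r, s, t⟩ := by
  rw [VariableChange.mul_def]
  simp

/-- **Potentially good reduction in terms of `c₄`**: `‖j(W')‖_p ≤ 1 ⇒ ‖c₄‖_p³ ≤ ‖Δ‖_p`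
(`jΔ = c₄³`). [cite: SilvermanAEC2009, VII.5.5] -/
theorem norm_c₄_pow_three_le_norm_Δ (W' : WeierstrassCurve ℚ) [W'.IsElliptic] {p : ℕ}
    [Fact p.Prime] (hj : ‖((W'.j : ℚ) : ℚ_[p])‖ ≤ 1) :
    ‖((W'.c₄ : ℚ) : ℚ_[p])‖ ^ 3 ≤ ‖((W'.Δ : ℚ) : ℚ_[p])‖ := by
  have hjΔ : W'.j * W'.Δ = W'.c₄ ^ 3 := by
    rw [WeierstrassCurve.j, ← WeierstrassCurve.coe_Δ', mul_assoc, mul_comm (W'.c₄ ^ 3),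
      ← mul_assoc, Units.inv_mul, one_mul]
  have h : ((W'.j : ℚ) : ℚ_[p]) * ((W'.Δ : ℚ) : ℚ_[p]) = ((W'.c₄ : ℚ) : ℚ_[p]) ^ 3 := by
    exact_mod_cast hjΔ
  rw [← norm_pow, ← h, norm_mul]
  exact mul_le_of_le_one_left (norm_nonneg _) hj

/-- **Kraus at `2`**: `v₂(Δ_min) ≥ 16` forces `c₄ ≠ 0` and `v₂(c₄) ≤ 7`
(`not_pow_dvd_c₄_minimalDiscriminantInt_two`). [cite: SilvermanAEC2009, VII.5.5, Ex. 7.1] -/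
theorem padicValInt_c₄_le_seven_of_le (W' : WeierstrassCurve ℚ) [W'.IsElliptic]
    [W'.IsGloballyMinimal] (hd : 16 ≤ padicValInt 2 (minimalDiscriminantInt W')) :
    (integralModelInt W').c₄ ≠ 0 ∧ padicValInt 2 (integralModelInt W').c₄ ≤ 7 := by
  have hK := not_pow_dvd_c₄_minimalDiscriminantInt_two W'
  have hΔ16 : (2 : ℤ) ^ 16 ∣ minimalDiscriminantInt W' := by
    exact_mod_cast (padicValInt_dvd_iff 16 _).mpr (Or.inr hd)
  refine ⟨fun h0 ↦ hK ⟨by rw [h0]; exact dvd_zero _, hΔ16⟩, ?_⟩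
  by_contra hc
  exact hK ⟨by exact_mod_cast (padicValInt_dvd_iff 8 _).mpr (Or.inr (by omega)), hΔ16⟩

/-- `‖2‖ = 2⁻¹` in `ℚ̄₂`. [folklore] -/
theorem norm_two_padicAlgCl_two : ‖(2 : PadicAlgCl 2)‖ = 2⁻¹ := by
  have h := norm_natCast_padicAlgCl (p := 2)
  push_cast at h
  exact h

/-- `‖r‖ = ‖r‖_p` for a rational `r` read in `ℚ̄_p`. [folklore] -/
theorem norm_algebraMap_padicAlgCl {p : ℕ} [Fact p.Prime] (r : ℚ) :
    ‖algebraMap ℚ (PadicAlgCl p) r‖ = ‖(r : ℚ_[p])‖ := by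
  rw [eq_ratCast, ← map_ratCast (algebraMap ℚ_[p] (PadicAlgCl p)) r]
  exact PadicAlgCl.norm_extends p _

/-- The coefficients `a₁, a₂, a₃, a₄, a₆` and `b₂, b₄, b₆, b₈` of a globally minimal `W'/ℚ` are
integers (`map_integralModelInt`), hence of norm `≤ 1` in `ℚ̄_p`. [folklore] -/
theorem norm_coeff_padicAlgCl_le_one (W' : WeierstrassCurve ℚ) [W'.IsGloballyMinimal] {p : ℕ}
    [Fact p.Prime] :
    ‖algebraMap ℚ (PadicAlgCl p) W'.a₁‖ ≤ 1 ∧ ‖algebraMap ℚ (PadicAlgCl p) W'.a₂‖ ≤ 1 ∧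
      ‖algebraMap ℚ (PadicAlgCl p) W'.a₃‖ ≤ 1 ∧ ‖algebraMap ℚ (PadicAlgCl p) W'.a₄‖ ≤ 1 ∧
      ‖algebraMap ℚ (PadicAlgCl p) W'.a₆‖ ≤ 1 ∧ ‖algebraMap ℚ (PadicAlgCl p) W'.b₂‖ ≤ 1 ∧
      ‖algebraMap ℚ (PadicAlgCl p) W'.b₄‖ ≤ 1 ∧ ‖algebraMap ℚ (PadicAlgCl p) W'.b₆‖ ≤ 1 ∧
      ‖algebraMap ℚ (PadicAlgCl p) W'.b₈‖ ≤ 1 := by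
  have hiW := map_integralModelInt W'
  have hint : ∀ z : ℤ, ‖algebraMap ℚ (PadicAlgCl p) (z : ℚ)‖ ≤ 1 := fun z ↦ by
    rw [norm_algebraMap_padicAlgCl, Rat.cast_intCast]; exact Padic.norm_int_le_one z
  have ha₁ := (integralModelInt W').map_a₁ (Int.castRingHom ℚ)
  have ha₂ := (integralModelInt W').map_a₂ (Int.castRingHom ℚ)
  have ha₃ := (integralModelInt W').map_a₃ (Int.castRingHom ℚ)
  have ha₄ := (integralModelInt W').map_a₄ (Int.castRingHom ℚ)
  have ha₆ := (integralModelInt W').map_a₆ (Int.castRingHom ℚ)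
  have hb₂ := (integralModelInt W').map_b₂ (Int.castRingHom ℚ)
  have hb₄ := (integralModelInt W').map_b₄ (Int.castRingHom ℚ)
  have hb₆ := (integralModelInt W').map_b₆ (Int.castRingHom ℚ)
  have hb₈ := (integralModelInt W').map_b₈ (Int.castRingHom ℚ)
  rw [hiW, eq_intCast] at ha₁ ha₂ ha₃ ha₄ ha₆ hb₂ hb₄ hb₆ hb₈
  rw [ha₁, ha₂, ha₃, ha₄, ha₆, hb₂, hb₄, hb₆, hb₈]
  exact ⟨hint _, hint _, hint _, hint _, hint _, hint _, hint _, hint _, hint _⟩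

/-- **A `2`-integral flex point.** For a globally minimal `W'/ℚ` there are `x₀, y₀ ∈ ℚ̄₂` of
norm `≤ 1` with `Ψ₃(x₀) = 3x₀⁴ + b₂x₀³ + 3b₄x₀² + 3b₆x₀ + b₈ = 0` and `(x₀, y₀)` on `W'`:
`ℚ̄₂` is algebraically closed, `Ψ₃` has the `2`-adic unit `3` as leading coefficient and
integral coefficients, and `y₀` is a root of a monic integral quadratic
(`norm_le_one_of_quartic_eq_zero`). [cite: SilvermanAEC2009, III.1 and Ex. 3.7] -/
theorem exists_flexPoint_padicAlgCl_two (W' : WeierstrassCurve ℚ) [W'.IsGloballyMinimal] :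
    ∃ x₀ y₀ : PadicAlgCl 2, ‖x₀‖ ≤ 1 ∧ ‖y₀‖ ≤ 1 ∧
      3 * x₀ ^ 4 + algebraMap ℚ (PadicAlgCl 2) W'.b₂ * x₀ ^ 3 +
        3 * algebraMap ℚ (PadicAlgCl 2) W'.b₄ * x₀ ^ 2 +
        3 * algebraMap ℚ (PadicAlgCl 2) W'.b₆ * x₀ + algebraMap ℚ (PadicAlgCl 2) W'.b₈ = 0 ∧
      y₀ ^ 2 + algebraMap ℚ (PadicAlgCl 2) W'.a₁ * x₀ * y₀ +
        algebraMap ℚ (PadicAlgCl 2) W'.a₃ * y₀ =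
        x₀ ^ 3 + algebraMap ℚ (PadicAlgCl 2) W'.a₂ * x₀ ^ 2 +
        algebraMap ℚ (PadicAlgCl 2) W'.a₄ * x₀ + algebraMap ℚ (PadicAlgCl 2) W'.a₆ := by
  set φA : ℚ →+* PadicAlgCl 2 := algebraMap ℚ (PadicAlgCl 2) with hφA
  obtain ⟨hna₁, hna₂, hna₃, hna₄, hna₆, hnb₂, hnb₄, hnb₆, hnb₈⟩ :=
    norm_coeff_padicAlgCl_le_one W' (p := 2)
  set W'A : WeierstrassCurve (PadicAlgCl 2) := W'.map φA with hW'A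
  have h3A : ‖(3 : PadicAlgCl 2)‖ = 1 := by
    have h := PadicAlgCl.norm_natCast_of_not_dvd (p := 2) (n := 3) (by norm_num)
    push_cast at h
    exact h
  have h3A0 : (3 : PadicAlgCl 2) ≠ 0 := by norm_num
  obtain ⟨x₀, hx₀⟩ := IsAlgClosed.exists_root W'A.Ψ₃ (by
    rw [Polynomial.degree_eq_natDegree (W'A.Ψ₃_ne_zero h3A0), W'A.natDegree_Ψ₃ h3A0]; norm_num)
  have hΨx₀ : 3 * x₀ ^ 4 + φA W'.b₂ * x₀ ^ 3 + 3 * φA W'.b₄ * x₀ ^ 2 + 3 * φA W'.b₆ * x₀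
      + φA W'.b₈ = 0 := by
    have h := hx₀
    simp only [Polynomial.IsRoot.def, WeierstrassCurve.Ψ₃, Polynomial.eval_add,
      Polynomial.eval_mul, Polynomial.eval_pow, Polynomial.eval_C, Polynomial.eval_X,
      Polynomial.eval_ofNat, hW'A, map_b₂, map_b₄, map_b₆, map_b₈] at h
    exact h
  -- `y₀`: complete the square in `y² + By = C`
  set B : PadicAlgCl 2 := φA W'.a₁ * x₀ + φA W'.a₃ with hB
  set Cc : PadicAlgCl 2 := x₀ ^ 3 + φA W'.a₂ * x₀ ^ 2 + φA W'.a₄ * x₀ + φA W'.a₆ with hCc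
  obtain ⟨D, hD⟩ := IsAlgClosed.exists_pow_nat_eq (B ^ 2 + 4 * Cc) two_pos
  set y₀ : PadicAlgCl 2 := (D - B) / 2 with hy₀
  have hy₀B : y₀ ^ 2 + B * y₀ - Cc = 0 := by
    have h2 : (2 : PadicAlgCl 2) ≠ 0 := two_ne_zero
    rw [hy₀]; field_simp; linear_combination hD
  -- integrality (root bounds)
  have hnx₀ : ‖x₀‖ ≤ 1 :=
    norm_le_one_of_quartic_eq_zero h3A hnb₂ (norm_mul_le_one h3A.le hnb₄)
      (norm_mul_le_one h3A.le hnb₆) hnb₈ hΨx₀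
  have hnx₀p : ∀ n : ℕ, ‖x₀ ^ n‖ ≤ 1 := fun n ↦ by
    rw [norm_pow]; exact pow_le_one₀ (norm_nonneg _) hnx₀
  have hnB : ‖B‖ ≤ 1 := norm_add_le_one (norm_mul_le_one hna₁ hnx₀) hna₃
  have hnCc : ‖Cc‖ ≤ 1 :=
    norm_add_le_one (norm_add_le_one (norm_add_le_one (hnx₀p 3)
      (norm_mul_le_one hna₂ (hnx₀p 2))) (norm_mul_le_one hna₄ hnx₀)) hna₆
  have hny₀ : ‖y₀‖ ≤ 1 :=
    norm_le_one_of_quartic_eq_zero (c₄ := 1) (c₃ := B) (c₂ := -Cc) (c₁ := 0) (c₀ := 0) norm_one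
      hnB (by rw [norm_neg]; exact hnCc) (by rw [norm_zero]; exact zero_le_one)
      (by rw [norm_zero]; exact zero_le_one) (by linear_combination y₀ ^ 2 * hy₀B)
  refine ⟨x₀, y₀, hnx₀, hny₀, hΨx₀, ?_⟩
  rw [← hCc]; rw [hB] at hy₀B; linear_combination hy₀B

/-- In `ℝ`: `a ^ m = a ^ n` with `0 < a < 1` forces `m = n`. [folklore] -/
theorem nat_eq_of_pow_eq {a : ℝ} (ha0 : 0 < a) (ha1 : a < 1) {m n : ℕ} (h : a ^ m = a ^ n) :
    m = n :=
  pow_right_injective₀ ha0 ha1.ne h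

end Summit.ABC.ABC.Theorems
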